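import Summits.Parity.GeneralizedHardyLittlewood.Theorems.PrimeLevelFamEdgeMomentsBeyondDiagonalDiagDecorOrderThreeThreeCombine
import HarnessLib

/-!
# Route `PrimeLevelFamEdge`, crux K_A `MomentsBeyondDiagonal` (stmt-Parity-20007), line «petersson_layers» v4, stub `stub_diag`:
# **bookkeeping of the order-`(4,4)` polynomial part (seventy pieces, main order `log⁶M`)**

Order-`(4,4)` twin of `…DiagDecorOrderTwoFourCombine` (p835729) and `…DiagDecorOrderThreeThreeCombine` (p831802): the linear
bookkeeping `orderFourFour_combine` of the seventy monomials of `…DiagDecorOrderFourFourSplit.selbergOrderFourFour_split` (poly₄₄,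
same order and coefficients) against abstract engine facts — `ττL^m`: `|S_m − KΦ_mℓ^mℓ/ℓ⁴| ≤ C_mℓ^m/ℓ⁴` (`m ≤ 9`); `τP₂τL^m` (+ mirror `'`):
`…/ℓ²` (`m ≤ 7`); `τP₂τP₂L^m`: `…/ℓ⁰` (`m ≤ 5`); the decorated families as crude hypotheses `|·| ≤ Cℓ^q`, `q ≤ 5`: `M₄` (`V`, `W`: `ℓ^m`,
`m ≤ 5`), `M₆` (`Y`, `Z`: `ℓ^{m+2}`, `m ≤ 3`), `M₄⊗P₂` (`R`, `R'`: `ℓ^{m+2}`, `m ≤ 3`), `M₈` (`N`, `N'`: `ℓ^{m+4}`, `m ≤ 1`), `M₆⊗P₂`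
(`X`, `X'`: `ℓ^{m+4}`, `m ≤ 1`), `M₄⊗M₄` (`O`: `ℓ^{m+4}`, `m ≤ 1`) — exactly the exponents of the landed engines `…DiagDecorM4Family`
(`log^m`), `…M6Family` / `…M4P2Family` (`log^{m+2}`), `…M8Family` / `…M6P2Family` / `…M4M4Family` (`log^{m+4}`). The top-degree pieces
`S₉`, `T₇`, `T₇'`, `U₅` carry the main term `K((1 / 4608) * Φ₉ + (-1 / 448) * Ψ₇ + (9 / 640) * Ξ₅)ℓ⁶`, the other sixty-six are `O(ℓ⁵)`.

* `poly44_piece_main` / `poly44_piece_low` / `poly44_piece_hyp` — the three piece shapes at main order `ℓ⁶`, error `ℓ⁵`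
  (the (3,3) ones `poly33_piece_*` are at `ℓ⁴`/`ℓ³`); `poly22_add_piece` is reused;
* `orderFourFour_combine` — the seventy-piece bookkeeping. Pure real-number algebra.

Def-free; theorems only. Helper `--supports stmt-Parity-20007`; closes nothing; K_A, K_B and the Parity summit are NOT proved;
nothing about Landau–Siegel zeros.

## References
* E. Kowalski, P. Michel, J. VanderKam, J. reine angew. Math. 526 (2000), (23)–(28) pp. 13–15 and Prop. 5.1 p. 18.
  [cite: KowalskiMichelVanderKam2000, (23)–(28) — derivation (order-(4,4) piece of the diagonal main term, general Q)]
-/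

noncomputable section

open Finset

namespace Summit.Parity.GeneralizedHardyLittlewood.Theorems.MomentsBeyondDiagonal.DiagKernel

/-- Top-degree piece at order `(4,4)`: `|S − KΦℓ^aℓ/ℓ^b| ≤ Cℓ^a/ℓ^b` with `a = b + 5` gives `|cS − cKΦℓ⁶| ≤ |c|Cℓ⁵`. [folklore] -/
theorem poly44_piece_main {S K Φ C ℓ : ℝ} (c : ℝ) {a b : ℕ} (hℓ : 1 ≤ ℓ) (hab : a = b + 5)
    (h : |S - K * Φ * ℓ ^ a * ℓ / ℓ ^ b| ≤ C * ℓ ^ a / ℓ ^ b) :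
    |c * S - c * (K * Φ) * ℓ ^ 6| ≤ |c| * C * ℓ ^ 5 := by
  subst hab
  have hℓ0 : 0 < ℓ := by linarith
  have e1 : K * Φ * ℓ ^ (b + 5) * ℓ / ℓ ^ b = K * Φ * ℓ ^ 6 := by
    rw [div_eq_iff (pow_ne_zero _ hℓ0.ne')]; ring
  have e2 : C * ℓ ^ (b + 5) / ℓ ^ b = C * ℓ ^ 5 := by
    rw [div_eq_iff (pow_ne_zero _ hℓ0.ne')]; ring
  rw [e1, e2] at h
  calc |c * S - c * (K * Φ) * ℓ ^ 6| = |c| * |S - K * Φ * ℓ ^ 6| := by rw [← abs_mul]; congr 1; ring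
    _ ≤ |c| * (C * ℓ ^ 5) := mul_le_mul_of_nonneg_left h (abs_nonneg c)
    _ = |c| * C * ℓ ^ 5 := by ring

/-- Lower-degree main-family piece at order `(4,4)`: `a ≤ b + 4` gives `|cS − 0·ℓ⁶| ≤ |c|(K|Φ| + C)ℓ⁵`. [folklore] -/
theorem poly44_piece_low {S K Φ C ℓ : ℝ} (c : ℝ) {a b : ℕ} (hℓ : 1 ≤ ℓ) (hK : 0 ≤ K) (hC : 0 ≤ C) (hab : a ≤ b + 4)
    (h : |S - K * Φ * ℓ ^ a * ℓ / ℓ ^ b| ≤ C * ℓ ^ a / ℓ ^ b) :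
    |c * S - 0 * ℓ ^ 6| ≤ |c| * (K * |Φ| + C) * ℓ ^ 5 := by
  have hℓ0 : 0 < ℓ := by linarith
  have hr : ℓ ^ a / ℓ ^ b ≤ ℓ ^ 4 := by
    rw [div_le_iff₀ (pow_pos hℓ0 _), ← pow_add]
    exact pow_le_pow_right₀ hℓ (by omega)
  have hr0 : 0 ≤ ℓ ^ a / ℓ ^ b := by positivity
  have hℓ4 : ℓ ^ 4 ≤ ℓ ^ 5 := pow_le_pow_right₀ hℓ (by norm_num)
  have h1 : |S| ≤ K * |Φ| * (ℓ ^ a / ℓ ^ b) * ℓ + C * (ℓ ^ a / ℓ ^ b) := by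
    have := abs_sub_abs_le_abs_sub S (K * Φ * ℓ ^ a * ℓ / ℓ ^ b)
    have hm : |K * Φ * ℓ ^ a * ℓ / ℓ ^ b| = K * |Φ| * (ℓ ^ a / ℓ ^ b) * ℓ := by
      rw [show K * Φ * ℓ ^ a * ℓ / ℓ ^ b = K * Φ * ((ℓ ^ a / ℓ ^ b) * ℓ) by ring, abs_mul, abs_mul,
        abs_of_nonneg hK, abs_of_nonneg (by positivity : (0 : ℝ) ≤ ℓ ^ a / ℓ ^ b * ℓ)]
      ring
    have e : C * ℓ ^ a / ℓ ^ b = C * (ℓ ^ a / ℓ ^ b) := by ring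
    rw [e] at h
    linarith
  have h2 : K * |Φ| * (ℓ ^ a / ℓ ^ b) * ℓ ≤ K * |Φ| * ℓ ^ 5 := by
    have : (ℓ ^ a / ℓ ^ b) * ℓ ≤ ℓ ^ 4 * ℓ := mul_le_mul_of_nonneg_right hr hℓ0.le
    have hK' : 0 ≤ K * |Φ| := mul_nonneg hK (abs_nonneg _)
    calc K * |Φ| * (ℓ ^ a / ℓ ^ b) * ℓ = K * |Φ| * ((ℓ ^ a / ℓ ^ b) * ℓ) := by ring
      _ ≤ K * |Φ| * (ℓ ^ 4 * ℓ) := mul_le_mul_of_nonneg_left this hK'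
      _ = K * |Φ| * ℓ ^ 5 := by ring
  have h3 : C * (ℓ ^ a / ℓ ^ b) ≤ C * ℓ ^ 5 := mul_le_mul_of_nonneg_left (hr.trans hℓ4) hC
  rw [zero_mul, sub_zero, abs_mul]
  calc |c| * |S| ≤ |c| * (K * |Φ| * ℓ ^ 5 + C * ℓ ^ 5) := mul_le_mul_of_nonneg_left (by linarith) (abs_nonneg c)
    _ = |c| * (K * |Φ| + C) * ℓ ^ 5 := by ring

/-- Crude-family piece at order `(4,4)`: `|S| ≤ Cℓ^p`, `p ≤ 5`, gives `|cS − 0·ℓ⁶| ≤ |c|Cℓ⁵`. [folklore] -/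
theorem poly44_piece_hyp {S C ℓ : ℝ} (c : ℝ) {p : ℕ} (hℓ : 1 ≤ ℓ) (hp : p ≤ 5) (h : |S| ≤ C * ℓ ^ p) :
    |c * S - 0 * ℓ ^ 6| ≤ |c| * C * ℓ ^ 5 := by
  have hℓ0 : 0 < ℓ := by linarith
  have hC : 0 ≤ C := by
    by_contra hC
    rw [not_le] at hC
    have : C * ℓ ^ p < 0 := mul_neg_of_neg_of_pos hC (pow_pos hℓ0 p)
    linarith [abs_nonneg S]
  have hp' : C * ℓ ^ p ≤ C * ℓ ^ 5 := mul_le_mul_of_nonneg_left (pow_le_pow_right₀ hℓ hp) hC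
  rw [zero_mul, sub_zero, abs_mul]
  calc |c| * |S| ≤ |c| * (C * ℓ ^ 5) := mul_le_mul_of_nonneg_left (h.trans hp') (abs_nonneg c)
    _ = |c| * C * ℓ ^ 5 := by ring

set_option maxHeartbeats 3200000 in
-- seventy-term linear bookkeeping
/-- **The bookkeeping of the seventy pieces at order `(4,4)`** (`K = (π²/6)²`, `ℓ = log M ≥ 1`): the top-degree pieces `S₉`,
`T₇`, `T₇'`, `U₅` carry the main term `K((1 / 4608) * Φ₉ + (-1 / 448) * Ψ₇ + (9 / 640) * Ξ₅)ℓ⁶`, the other sixty-six are `O(ℓ⁵)`. [folklore] -/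
theorem orderFourFour_combine
    {S₉ S₈ S₇ S₆ S₅ S₄ S₃ S₂ S₁ S₀ T₇ T₆ T₅ T₄ T₃ T₂ T₁ T₀ T₇' T₆' T₅' T₄' T₃' T₂' T₁' T₀' U₅ U₄ U₃ U₂ U₁ U₀ V₅ V₄ V₃ V₂ V₁ V₀ W₅ W₄ W₃ W₂ W₁ W₀ Y₃ Y₂ Y₁ Y₀ Z₃ Z₂ Z₁ Z₀ R₃ R₂ R₁ R₀ R₃' R₂' R₁' R₀' N₁ N₀ N₁' N₀' X₁ X₀ X₁' X₀' O₁ O₀ : ℝ}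
    {Ξ₅ Ξ₄ Ξ₃ Ξ₂ Ξ₁ Ξ₀ Φ₉ Φ₈ Φ₇ Φ₆ Φ₅ Φ₄ Φ₃ Φ₂ Φ₁ Φ₀ Ψ₇ Ψ₆ Ψ₅ Ψ₄ Ψ₃ Ψ₂ Ψ₁ Ψ₀ : ℝ}
    {C₉ C₈ C₇ C₆ C₅ C₄ C₃ C₂ C₁ C₀ D₇ D₆ D₅ D₄ D₃ D₂ D₁ D₀ D₇' D₆' D₅' D₄' D₃' D₂' D₁' D₀' G₅ G₄ G₃ G₂ G₁ G₀ A₅ A₄ A₃ A₂ A₁ A₀ B₅ B₄ B₃ B₂ B₁ B₀ CY₃ CY₂ CY₁ CY₀ CZ₃ CZ₂ CZ₁ CZ₀ CR₃ CR₂ CR₁ CR₀ CR₃' CR₂' CR₁' CR₀' CN₁ CN₀ CN₁' CN₀' CX₁ CX₀ CX₁' CX₀' CO₁ CO₀ : ℝ}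
    {E₀₀ E₀₁ E₀₂ E₀₃ E₀₄ E₁₀ E₁₁ E₁₂ E₁₃ E₁₄ E₂₀ E₂₁ E₂₂ E₂₃ E₂₄ E₃₀ E₃₁ E₃₂ E₃₃ E₃₄ E₄₀ E₄₁ E₄₂ E₄₃ E₄₄ μ₂ μ₄ μ₆ μ₈ ℓ K : ℝ} (hℓ : 1 ≤ ℓ) (hK : 0 ≤ K)
    (hC₈ : 0 ≤ C₈) (hC₇ : 0 ≤ C₇) (hC₆ : 0 ≤ C₆) (hC₅ : 0 ≤ C₅) (hC₄ : 0 ≤ C₄) (hC₃ : 0 ≤ C₃) (hC₂ : 0 ≤ C₂) (hC₁ : 0 ≤ C₁) (hC₀ : 0 ≤ C₀) (hD₆ : 0 ≤ D₆) (hD₅ : 0 ≤ D₅) (hD₄ : 0 ≤ D₄) (hD₃ : 0 ≤ D₃) (hD₂ : 0 ≤ D₂) (hD₁ : 0 ≤ D₁) (hD₀ : 0 ≤ D₀) (hD₆' : 0 ≤ D₆') (hD₅' : 0 ≤ D₅') (hD₄' : 0 ≤ D₄') (hD₃' : 0 ≤ D₃') (hD₂' : 0 ≤ D₂') (hD₁'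 : 0 ≤ D₁') (hD₀' : 0 ≤ D₀') (hG₄ : 0 ≤ G₄) (hG₃ : 0 ≤ G₃) (hG₂ : 0 ≤ G₂) (hG₁ : 0 ≤ G₁) (hG₀ : 0 ≤ G₀)
    (h9 : |S₉ - K * Φ₉ * ℓ ^ 9 * ℓ / ℓ ^ 4| ≤ C₉ * ℓ ^ 9 / ℓ ^ 4) (h8 : |S₈ - K * Φ₈ * ℓ ^ 8 * ℓ / ℓ ^ 4| ≤ C₈ * ℓ ^ 8 / ℓ ^ 4)
    (h7 : |S₇ - K * Φ₇ * ℓ ^ 7 * ℓ / ℓ ^ 4| ≤ C₇ * ℓ ^ 7 / ℓ ^ 4) (h6 : |S₆ - K * Φ₆ * ℓ ^ 6 * ℓ / ℓ ^ 4| ≤ C₆ * ℓ ^ 6 / ℓ ^ 4)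
    (h5 : |S₅ - K * Φ₅ * ℓ ^ 5 * ℓ / ℓ ^ 4| ≤ C₅ * ℓ ^ 5 / ℓ ^ 4) (h4 : |S₄ - K * Φ₄ * ℓ ^ 4 * ℓ / ℓ ^ 4| ≤ C₄ * ℓ ^ 4 / ℓ ^ 4)
    (h3 : |S₃ - K * Φ₃ * ℓ ^ 3 * ℓ / ℓ ^ 4| ≤ C₃ * ℓ ^ 3 / ℓ ^ 4) (h2 : |S₂ - K * Φ₂ * ℓ ^ 2 * ℓ / ℓ ^ 4| ≤ C₂ * ℓ ^ 2 / ℓ ^ 4)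
    (h1 : |S₁ - K * Φ₁ * ℓ ^ 1 * ℓ / ℓ ^ 4| ≤ C₁ * ℓ ^ 1 / ℓ ^ 4) (h0 : |S₀ - K * Φ₀ * ℓ ^ 0 * ℓ / ℓ ^ 4| ≤ C₀ * ℓ ^ 0 / ℓ ^ 4)
    (g7 : |T₇ - K * Ψ₇ * ℓ ^ 7 * ℓ / ℓ ^ 2| ≤ D₇ * ℓ ^ 7 / ℓ ^ 2) (g6 : |T₆ - K * Ψ₆ * ℓ ^ 6 * ℓ / ℓ ^ 2| ≤ D₆ * ℓ ^ 6 / ℓ ^ 2)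
    (g5 : |T₅ - K * Ψ₅ * ℓ ^ 5 * ℓ / ℓ ^ 2| ≤ D₅ * ℓ ^ 5 / ℓ ^ 2) (g4 : |T₄ - K * Ψ₄ * ℓ ^ 4 * ℓ / ℓ ^ 2| ≤ D₄ * ℓ ^ 4 / ℓ ^ 2)
    (g3 : |T₃ - K * Ψ₃ * ℓ ^ 3 * ℓ / ℓ ^ 2| ≤ D₃ * ℓ ^ 3 / ℓ ^ 2) (g2 : |T₂ - K * Ψ₂ * ℓ ^ 2 * ℓ / ℓ ^ 2| ≤ D₂ * ℓ ^ 2 / ℓ ^ 2)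
    (g1 : |T₁ - K * Ψ₁ * ℓ ^ 1 * ℓ / ℓ ^ 2| ≤ D₁ * ℓ ^ 1 / ℓ ^ 2) (g0 : |T₀ - K * Ψ₀ * ℓ ^ 0 * ℓ / ℓ ^ 2| ≤ D₀ * ℓ ^ 0 / ℓ ^ 2)
    (g7p : |T₇' - K * Ψ₇ * ℓ ^ 7 * ℓ / ℓ ^ 2| ≤ D₇' * ℓ ^ 7 / ℓ ^ 2) (g6p : |T₆' - K * Ψ₆ * ℓ ^ 6 * ℓ / ℓ ^ 2| ≤ D₆' * ℓ ^ 6 / ℓ ^ 2)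
    (g5p : |T₅' - K * Ψ₅ * ℓ ^ 5 * ℓ / ℓ ^ 2| ≤ D₅' * ℓ ^ 5 / ℓ ^ 2) (g4p : |T₄' - K * Ψ₄ * ℓ ^ 4 * ℓ / ℓ ^ 2| ≤ D₄' * ℓ ^ 4 / ℓ ^ 2)
    (g3p : |T₃' - K * Ψ₃ * ℓ ^ 3 * ℓ / ℓ ^ 2| ≤ D₃' * ℓ ^ 3 / ℓ ^ 2) (g2p : |T₂' - K * Ψ₂ * ℓ ^ 2 * ℓ / ℓ ^ 2| ≤ D₂' * ℓ ^ 2 / ℓ ^ 2)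
    (g1p : |T₁' - K * Ψ₁ * ℓ ^ 1 * ℓ / ℓ ^ 2| ≤ D₁' * ℓ ^ 1 / ℓ ^ 2) (g0p : |T₀' - K * Ψ₀ * ℓ ^ 0 * ℓ / ℓ ^ 2| ≤ D₀' * ℓ ^ 0 / ℓ ^ 2)
    (u5 : |U₅ - K * Ξ₅ * ℓ ^ 5 * ℓ / ℓ ^ 0| ≤ G₅ * ℓ ^ 5 / ℓ ^ 0) (u4 : |U₄ - K * Ξ₄ * ℓ ^ 4 * ℓ / ℓ ^ 0| ≤ G₄ * ℓ ^ 4 / ℓ ^ 0)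
    (u3 : |U₃ - K * Ξ₃ * ℓ ^ 3 * ℓ / ℓ ^ 0| ≤ G₃ * ℓ ^ 3 / ℓ ^ 0) (u2 : |U₂ - K * Ξ₂ * ℓ ^ 2 * ℓ / ℓ ^ 0| ≤ G₂ * ℓ ^ 2 / ℓ ^ 0)
    (u1 : |U₁ - K * Ξ₁ * ℓ ^ 1 * ℓ / ℓ ^ 0| ≤ G₁ * ℓ ^ 1 / ℓ ^ 0) (u0 : |U₀ - K * Ξ₀ * ℓ ^ 0 * ℓ / ℓ ^ 0| ≤ G₀ * ℓ ^ 0 / ℓ ^ 0)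
    (v5 : |V₅| ≤ A₅ * ℓ ^ 5) (v4 : |V₄| ≤ A₄ * ℓ ^ 4)
    (v3 : |V₃| ≤ A₃ * ℓ ^ 3) (v2 : |V₂| ≤ A₂ * ℓ ^ 2)
    (v1 : |V₁| ≤ A₁ * ℓ ^ 1) (v0 : |V₀| ≤ A₀ * ℓ ^ 0)
    (w5 : |W₅| ≤ B₅ * ℓ ^ 5) (w4 : |W₄| ≤ B₄ * ℓ ^ 4)
    (w3 : |W₃| ≤ B₃ * ℓ ^ 3) (w2 : |W₂| ≤ B₂ * ℓ ^ 2)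
    (w1 : |W₁| ≤ B₁ * ℓ ^ 1) (w0 : |W₀| ≤ B₀ * ℓ ^ 0)
    (y3 : |Y₃| ≤ CY₃ * ℓ ^ (3 + 2)) (y2 : |Y₂| ≤ CY₂ * ℓ ^ (2 + 2))
    (y1 : |Y₁| ≤ CY₁ * ℓ ^ (1 + 2)) (y0 : |Y₀| ≤ CY₀ * ℓ ^ (0 + 2))
    (z3 : |Z₃| ≤ CZ₃ * ℓ ^ (3 + 2)) (z2 : |Z₂| ≤ CZ₂ * ℓ ^ (2 + 2))
    (z1 : |Z₁| ≤ CZ₁ * ℓ ^ (1 + 2)) (z0 : |Z₀| ≤ CZ₀ * ℓ ^ (0 + 2))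
    (r3 : |R₃| ≤ CR₃ * ℓ ^ (3 + 2)) (r2 : |R₂| ≤ CR₂ * ℓ ^ (2 + 2))
    (r1 : |R₁| ≤ CR₁ * ℓ ^ (1 + 2)) (r0 : |R₀| ≤ CR₀ * ℓ ^ (0 + 2))
    (r3p : |R₃'| ≤ CR₃' * ℓ ^ (3 + 2)) (r2p : |R₂'| ≤ CR₂' * ℓ ^ (2 + 2))
    (r1p : |R₁'| ≤ CR₁' * ℓ ^ (1 + 2)) (r0p : |R₀'| ≤ CR₀' * ℓ ^ (0 + 2))
    (n1 : |N₁| ≤ CN₁ * ℓ ^ (1 + 4)) (n0 : |N₀| ≤ CN₀ * ℓ ^ (0 + 4))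
    (n1p : |N₁'| ≤ CN₁' * ℓ ^ (1 + 4)) (n0p : |N₀'| ≤ CN₀' * ℓ ^ (0 + 4))
    (x1 : |X₁| ≤ CX₁ * ℓ ^ (1 + 4)) (x0 : |X₀| ≤ CX₀ * ℓ ^ (0 + 4))
    (x1p : |X₁'| ≤ CX₁' * ℓ ^ (1 + 4)) (x0p : |X₀'| ≤ CX₀' * ℓ ^ (0 + 4))
    (o1 : |O₁| ≤ CO₁ * ℓ ^ (1 + 4)) (o0 : |O₀| ≤ CO₀ * ℓ ^ (0 + 4)) :
    |((1 / 4608) * S₉ +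
        (E₀₀ / 256) * S₈ +
        (E₀₁ / 32 + E₁₀ / 32 - μ₂ / 56) * S₇ +
        (3 * E₀₂ / 32 + E₁₁ / 4 + 3 * E₂₀ / 32) * S₆ +
        (E₀₃ / 8 + 3 * E₁₂ / 4 + 3 * E₂₁ / 4 + E₃₀ / 8 + 3 * μ₄ / 20) * S₅ +
        (E₀₄ / 16 + E₁₃ + 9 * E₂₂ / 4 + E₃₁ + E₄₀ / 16) * S₄ +
        (E₁₄ / 2 + 3 * E₂₃ + 3 * E₃₂ + E₄₁ / 2 - 2 * μ₆ / 3) * S₃ +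
        (3 * E₂₄ / 2 + 4 * E₃₃ + 3 * E₄₂ / 2) * S₂ +
        (2 * E₃₄ + 2 * E₄₃ + 2 * μ₈) * S₁ +
        (E₄₄) * S₀ +
        (-1 / 896) * T₇ +
        (-E₀₀ / 64) * T₆ +
        (-3 * E₀₁ / 32 - 3 * E₁₀ / 32 + 9 * μ₂ / 40) * T₅ +
        (-3 * E₀₂ / 32 - 3 * E₁₁ / 4 - 3 * E₂₀ / 32) * T₄ +
        (E₀₃ / 4 - 3 * E₁₂ / 2 - 3 * E₂₁ / 2 + E₃₀ / 4 - 5 * μ₄ / 2) * T₃ +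
        (3 * E₀₄ / 8 - 9 * E₂₂ / 2 + 3 * E₄₀ / 8) * T₂ +
        (3 * E₁₄ / 2 - 3 * E₂₃ - 3 * E₃₂ + 3 * E₄₁ / 2 + 14 * μ₆) * T₁ +
        (3 * E₂₄ / 2 - 4 * E₃₃ + 3 * E₄₂ / 2) * T₀ +
        (-1 / 896) * T₇' +
        (-E₀₀ / 64) * T₆' +
        (-3 * E₀₁ / 32 - 3 * E₁₀ / 32 + 9 * μ₂ / 40) * T₅' +
        (-3 * E₀₂ / 32 - 3 * E₁₁ / 4 - 3 * E₂₀ / 32) * T₄' +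
        (E₀₃ / 4 - 3 * E₁₂ / 2 - 3 * E₂₁ / 2 + E₃₀ / 4 - 5 * μ₄ / 2) * T₃' +
        (3 * E₀₄ / 8 - 9 * E₂₂ / 2 + 3 * E₄₀ / 8) * T₂' +
        (3 * E₁₄ / 2 - 3 * E₂₃ - 3 * E₃₂ + 3 * E₄₁ / 2 + 14 * μ₆) * T₁' +
        (3 * E₂₄ / 2 - 4 * E₃₃ + 3 * E₄₂ / 2) * T₀' +
        (9 / 640) * U₅ +
        (9 * E₀₀ / 64) * U₄ +
        (9 * E₀₁ / 16 + 9 * E₁₀ / 16 - 15 * μ₂ / 4) * U₃ +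
        (-9 * E₀₂ / 16 + 9 * E₁₁ / 2 - 9 * E₂₀ / 16) * U₂ +
        (-9 * E₀₃ / 4 + 9 * E₁₂ / 2 + 9 * E₂₁ / 2 - 9 * E₃₀ / 4 + 105 * μ₄ / 2) * U₁ +
        (3 * E₀₄ / 8 - 6 * E₁₃ + 27 * E₂₂ / 2 - 6 * E₃₁ + 3 * E₄₀ / 8) * U₀ +
        (3 / 1280) * V₅ +
        (3 * E₀₀ / 128) * V₄ +
        (3 * E₀₁ / 32 + 3 * E₁₀ / 32 - 5 * μ₂ / 8) * V₃ +
        (-3 * E₀₂ / 32 + 3 * E₁₁ / 4 - 3 * E₂₀ / 32) * V₂ +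
        (-3 * E₀₃ / 8 + 3 * E₁₂ / 4 + 3 * E₂₁ / 4 - 3 * E₃₀ / 8 + 35 * μ₄ / 4) * V₁ +
        (E₀₄ / 16 - E₁₃ + 9 * E₂₂ / 4 - E₃₁ + E₄₀ / 16) * V₀ +
        (3 / 1280) * W₅ +
        (3 * E₀₀ / 128) * W₄ +
        (3 * E₀₁ / 32 + 3 * E₁₀ / 32 - 5 * μ₂ / 8) * W₃ +
        (-3 * E₀₂ / 32 + 3 * E₁₁ / 4 - 3 * E₂₀ / 32) * W₂ +
        (-3 * E₀₃ / 8 + 3 * E₁₂ / 4 + 3 * E₂₁ / 4 - 3 * E₃₀ / 8 + 35 * μ₄ / 4) * W₁ +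
        (E₀₄ / 16 - E₁₃ + 9 * E₂₂ / 4 - E₃₁ + E₄₀ / 16) * W₀ +
        (-1 / 384) * Y₃ +
        (-E₀₀ / 64) * Y₂ +
        (-E₀₁ / 32 - E₁₀ / 32 + 7 * μ₂ / 8) * Y₁ +
        (3 * E₀₂ / 32 - E₁₁ / 4 + 3 * E₂₀ / 32) * Y₀ +
        (-1 / 384) * Z₃ +
        (-E₀₀ / 64) * Z₂ +
        (-E₀₁ / 32 - E₁₀ / 32 + 7 * μ₂ / 8) * Z₁ +
        (3 * E₀₂ / 32 - E₁₁ / 4 + 3 * E₂₀ / 32) * Z₀ +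
        (-5 / 128) * R₃ +
        (-15 * E₀₀ / 64) * R₂ +
        (-15 * E₀₁ / 32 - 15 * E₁₀ / 32 + 105 * μ₂ / 8) * R₁ +
        (45 * E₀₂ / 32 - 15 * E₁₁ / 4 + 45 * E₂₀ / 32) * R₀ +
        (-5 / 128) * R₃' +
        (-15 * E₀₀ / 64) * R₂' +
        (-15 * E₀₁ / 32 - 15 * E₁₀ / 32 + 105 * μ₂ / 8) * R₁' +
        (45 * E₀₂ / 32 - 15 * E₁₁ / 4 + 45 * E₂₀ / 32) * R₀' +
        (1 / 512) * N₁ +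
        (E₀₀ / 256) * N₀ +
        (1 / 512) * N₁' +
        (E₀₀ / 256) * N₀' +
        (7 / 128) * X₁ +
        (7 * E₀₀ / 64) * X₀ +
        (7 / 128) * X₁' +
        (7 * E₀₀ / 64) * X₀' +
        (35 / 256) * O₁ +
        (35 * E₀₀ / 128) * O₀) -
        K * ((1 / 4608) * Φ₉ + (-1 / 448) * Ψ₇ + (9 / 640) * Ξ₅) * ℓ ^ 6| ≤
      (|((1 / 4608) : ℝ)| * C₉ +
        |((E₀₀ / 256) : ℝ)| * (K * |Φ₈| + C₈) +
        |((E₀₁ / 32 + E₁₀ / 32 - μ₂ / 56) : ℝ)| * (K * |Φ₇| + C₇) +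
        |((3 * E₀₂ / 32 + E₁₁ / 4 + 3 * E₂₀ / 32) : ℝ)| * (K * |Φ₆| + C₆) +
        |((E₀₃ / 8 + 3 * E₁₂ / 4 + 3 * E₂₁ / 4 + E₃₀ / 8 + 3 * μ₄ / 20) : ℝ)| * (K * |Φ₅| + C₅) +
        |((E₀₄ / 16 + E₁₃ + 9 * E₂₂ / 4 + E₃₁ + E₄₀ / 16) : ℝ)| * (K * |Φ₄| + C₄) +
        |((E₁₄ / 2 + 3 * E₂₃ + 3 * E₃₂ + E₄₁ / 2 - 2 * μ₆ / 3) : ℝ)| * (K * |Φ₃| + C₃) +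
        |((3 * E₂₄ / 2 + 4 * E₃₃ + 3 * E₄₂ / 2) : ℝ)| * (K * |Φ₂| + C₂) +
        |((2 * E₃₄ + 2 * E₄₃ + 2 * μ₈) : ℝ)| * (K * |Φ₁| + C₁) +
        |((E₄₄) : ℝ)| * (K * |Φ₀| + C₀) +
        |((-1 / 896) : ℝ)| * D₇ +
        |((-E₀₀ / 64) : ℝ)| * (K * |Ψ₆| + D₆) +
        |((-3 * E₀₁ / 32 - 3 * E₁₀ / 32 + 9 * μ₂ / 40) : ℝ)| * (K * |Ψ₅| + D₅) +
        |((-3 * E₀₂ / 32 - 3 * E₁₁ / 4 - 3 * E₂₀ / 32) : ℝ)| * (K * |Ψ₄| + D₄) +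
        |((E₀₃ / 4 - 3 * E₁₂ / 2 - 3 * E₂₁ / 2 + E₃₀ / 4 - 5 * μ₄ / 2) : ℝ)| * (K * |Ψ₃| + D₃) +
        |((3 * E₀₄ / 8 - 9 * E₂₂ / 2 + 3 * E₄₀ / 8) : ℝ)| * (K * |Ψ₂| + D₂) +
        |((3 * E₁₄ / 2 - 3 * E₂₃ - 3 * E₃₂ + 3 * E₄₁ / 2 + 14 * μ₆) : ℝ)| * (K * |Ψ₁| + D₁) +
        |((3 * E₂₄ / 2 - 4 * E₃₃ + 3 * E₄₂ / 2) : ℝ)| * (K * |Ψ₀| + D₀) +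
        |((-1 / 896) : ℝ)| * D₇' +
        |((-E₀₀ / 64) : ℝ)| * (K * |Ψ₆| + D₆') +
        |((-3 * E₀₁ / 32 - 3 * E₁₀ / 32 + 9 * μ₂ / 40) : ℝ)| * (K * |Ψ₅| + D₅') +
        |((-3 * E₀₂ / 32 - 3 * E₁₁ / 4 - 3 * E₂₀ / 32) : ℝ)| * (K * |Ψ₄| + D₄') +
        |((E₀₃ / 4 - 3 * E₁₂ / 2 - 3 * E₂₁ / 2 + E₃₀ / 4 - 5 * μ₄ / 2) : ℝ)| * (K * |Ψ₃| + D₃') +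
        |((3 * E₀₄ / 8 - 9 * E₂₂ / 2 + 3 * E₄₀ / 8) : ℝ)| * (K * |Ψ₂| + D₂') +
        |((3 * E₁₄ / 2 - 3 * E₂₃ - 3 * E₃₂ + 3 * E₄₁ / 2 + 14 * μ₆) : ℝ)| * (K * |Ψ₁| + D₁') +
        |((3 * E₂₄ / 2 - 4 * E₃₃ + 3 * E₄₂ / 2) : ℝ)| * (K * |Ψ₀| + D₀') +
        |((9 / 640) : ℝ)| * G₅ +
        |((9 * E₀₀ / 64) : ℝ)| * (K * |Ξ₄| + G₄) +
        |((9 * E₀₁ / 16 + 9 * E₁₀ / 16 - 15 * μ₂ / 4) : ℝ)| * (K * |Ξ₃| + G₃) +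
        |((-9 * E₀₂ / 16 + 9 * E₁₁ / 2 - 9 * E₂₀ / 16) : ℝ)| * (K * |Ξ₂| + G₂) +
        |((-9 * E₀₃ / 4 + 9 * E₁₂ / 2 + 9 * E₂₁ / 2 - 9 * E₃₀ / 4 + 105 * μ₄ / 2) : ℝ)| * (K * |Ξ₁| + G₁) +
        |((3 * E₀₄ / 8 - 6 * E₁₃ + 27 * E₂₂ / 2 - 6 * E₃₁ + 3 * E₄₀ / 8) : ℝ)| * (K * |Ξ₀| + G₀) +
        |((3 / 1280) : ℝ)| * A₅ +
        |((3 * E₀₀ / 128) : ℝ)| * A₄ +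
        |((3 * E₀₁ / 32 + 3 * E₁₀ / 32 - 5 * μ₂ / 8) : ℝ)| * A₃ +
        |((-3 * E₀₂ / 32 + 3 * E₁₁ / 4 - 3 * E₂₀ / 32) : ℝ)| * A₂ +
        |((-3 * E₀₃ / 8 + 3 * E₁₂ / 4 + 3 * E₂₁ / 4 - 3 * E₃₀ / 8 + 35 * μ₄ / 4) : ℝ)| * A₁ +
        |((E₀₄ / 16 - E₁₃ + 9 * E₂₂ / 4 - E₃₁ + E₄₀ / 16) : ℝ)| * A₀ +
        |((3 / 1280) : ℝ)| * B₅ +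
        |((3 * E₀₀ / 128) : ℝ)| * B₄ +
        |((3 * E₀₁ / 32 + 3 * E₁₀ / 32 - 5 * μ₂ / 8) : ℝ)| * B₃ +
        |((-3 * E₀₂ / 32 + 3 * E₁₁ / 4 - 3 * E₂₀ / 32) : ℝ)| * B₂ +
        |((-3 * E₀₃ / 8 + 3 * E₁₂ / 4 + 3 * E₂₁ / 4 - 3 * E₃₀ / 8 + 35 * μ₄ / 4) : ℝ)| * B₁ +
        |((E₀₄ / 16 - E₁₃ + 9 * E₂₂ / 4 - E₃₁ + E₄₀ / 16) : ℝ)| * B₀ +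
        |((-1 / 384) : ℝ)| * CY₃ +
        |((-E₀₀ / 64) : ℝ)| * CY₂ +
        |((-E₀₁ / 32 - E₁₀ / 32 + 7 * μ₂ / 8) : ℝ)| * CY₁ +
        |((3 * E₀₂ / 32 - E₁₁ / 4 + 3 * E₂₀ / 32) : ℝ)| * CY₀ +
        |((-1 / 384) : ℝ)| * CZ₃ +
        |((-E₀₀ / 64) : ℝ)| * CZ₂ +
        |((-E₀₁ / 32 - E₁₀ / 32 + 7 * μ₂ / 8) : ℝ)| * CZ₁ +
        |((3 * E₀₂ / 32 - E₁₁ / 4 + 3 * E₂₀ / 32) : ℝ)| * CZ₀ +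
        |((-5 / 128) : ℝ)| * CR₃ +
        |((-15 * E₀₀ / 64) : ℝ)| * CR₂ +
        |((-15 * E₀₁ / 32 - 15 * E₁₀ / 32 + 105 * μ₂ / 8) : ℝ)| * CR₁ +
        |((45 * E₀₂ / 32 - 15 * E₁₁ / 4 + 45 * E₂₀ / 32) : ℝ)| * CR₀ +
        |((-5 / 128) : ℝ)| * CR₃' +
        |((-15 * E₀₀ / 64) : ℝ)| * CR₂' +
        |((-15 * E₀₁ / 32 - 15 * E₁₀ / 32 + 105 * μ₂ / 8) : ℝ)| * CR₁' +
        |((45 * E₀₂ / 32 - 15 * E₁₁ / 4 + 45 * E₂₀ / 32) : ℝ)| * CR₀' +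
        |((1 / 512) : ℝ)| * CN₁ +
        |((E₀₀ / 256) : ℝ)| * CN₀ +
        |((1 / 512) : ℝ)| * CN₁' +
        |((E₀₀ / 256) : ℝ)| * CN₀' +
        |((7 / 128) : ℝ)| * CX₁ +
        |((7 * E₀₀ / 64) : ℝ)| * CX₀ +
        |((7 / 128) : ℝ)| * CX₁' +
        |((7 * E₀₀ / 64) : ℝ)| * CX₀' +
        |((35 / 256) : ℝ)| * CO₁ +
        |((35 * E₀₀ / 128) : ℝ)| * CO₀) * ℓ ^ 5 := by
  have H2 := poly22_add_piece (poly44_piece_main ((1 / 4608) : ℝ) hℓ rfl h9) (poly44_piece_low ((E₀₀ / 256) : ℝ) hℓ hK hC₈ (by norm_num) h8)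
  have H3 := poly22_add_piece H2 (poly44_piece_low ((E₀₁ / 32 + E₁₀ / 32 - μ₂ / 56) : ℝ) hℓ hK hC₇ (by norm_num) h7)
  have H4 := poly22_add_piece H3 (poly44_piece_low ((3 * E₀₂ / 32 + E₁₁ / 4 + 3 * E₂₀ / 32) : ℝ) hℓ hK hC₆ (by norm_num) h6)
  have H5 := poly22_add_piece H4 (poly44_piece_low ((E₀₃ / 8 + 3 * E₁₂ / 4 + 3 * E₂₁ / 4 + E₃₀ / 8 + 3 * μ₄ / 20) : ℝ) hℓ hK hC₅ (by norm_num) h5)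
  have H6 := poly22_add_piece H5 (poly44_piece_low ((E₀₄ / 16 + E₁₃ + 9 * E₂₂ / 4 + E₃₁ + E₄₀ / 16) : ℝ) hℓ hK hC₄ (by norm_num) h4)
  have H7 := poly22_add_piece H6 (poly44_piece_low ((E₁₄ / 2 + 3 * E₂₃ + 3 * E₃₂ + E₄₁ / 2 - 2 * μ₆ / 3) : ℝ) hℓ hK hC₃ (by norm_num) h3)
  have H8 := poly22_add_piece H7 (poly44_piece_low ((3 * E₂₄ / 2 + 4 * E₃₃ + 3 * E₄₂ / 2) : ℝ) hℓ hK hC₂ (by norm_num) h2)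
  have H9 := poly22_add_piece H8 (poly44_piece_low ((2 * E₃₄ + 2 * E₄₃ + 2 * μ₈) : ℝ) hℓ hK hC₁ (by norm_num) h1)
  have H10 := poly22_add_piece H9 (poly44_piece_low ((E₄₄) : ℝ) hℓ hK hC₀ (by norm_num) h0)
  have H11 := poly22_add_piece H10 (poly44_piece_main ((-1 / 896) : ℝ) hℓ rfl g7)
  have H12 := poly22_add_piece H11 (poly44_piece_low ((-E₀₀ / 64) : ℝ) hℓ hK hD₆ (by norm_num) g6)
  have H13 := poly22_add_piece H12 (poly44_piece_low ((-3 * E₀₁ / 32 - 3 * E₁₀ / 32 + 9 * μ₂ / 40) : ℝ) hℓ hK hD₅ (by norm_num) g5)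
  have H14 := poly22_add_piece H13 (poly44_piece_low ((-3 * E₀₂ / 32 - 3 * E₁₁ / 4 - 3 * E₂₀ / 32) : ℝ) hℓ hK hD₄ (by norm_num) g4)
  have H15 := poly22_add_piece H14 (poly44_piece_low ((E₀₃ / 4 - 3 * E₁₂ / 2 - 3 * E₂₁ / 2 + E₃₀ / 4 - 5 * μ₄ / 2) : ℝ) hℓ hK hD₃ (by norm_num) g3)
  have H16 := poly22_add_piece H15 (poly44_piece_low ((3 * E₀₄ / 8 - 9 * E₂₂ / 2 + 3 * E₄₀ / 8) : ℝ) hℓ hK hD₂ (by norm_num) g2)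
  have H17 := poly22_add_piece H16 (poly44_piece_low ((3 * E₁₄ / 2 - 3 * E₂₃ - 3 * E₃₂ + 3 * E₄₁ / 2 + 14 * μ₆) : ℝ) hℓ hK hD₁ (by norm_num) g1)
  have H18 := poly22_add_piece H17 (poly44_piece_low ((3 * E₂₄ / 2 - 4 * E₃₃ + 3 * E₄₂ / 2) : ℝ) hℓ hK hD₀ (by norm_num) g0)
  have H19 := poly22_add_piece H18 (poly44_piece_main ((-1 / 896) : ℝ) hℓ rfl g7p)
  have H20 := poly22_add_piece H19 (poly44_piece_low ((-E₀₀ / 64) : ℝ) hℓ hK hD₆' (by norm_num) g6p)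
  have H21 := poly22_add_piece H20 (poly44_piece_low ((-3 * E₀₁ / 32 - 3 * E₁₀ / 32 + 9 * μ₂ / 40) : ℝ) hℓ hK hD₅' (by norm_num) g5p)
  have H22 := poly22_add_piece H21 (poly44_piece_low ((-3 * E₀₂ / 32 - 3 * E₁₁ / 4 - 3 * E₂₀ / 32) : ℝ) hℓ hK hD₄' (by norm_num) g4p)
  have H23 := poly22_add_piece H22 (poly44_piece_low ((E₀₃ / 4 - 3 * E₁₂ / 2 - 3 * E₂₁ / 2 + E₃₀ / 4 - 5 * μ₄ / 2) : ℝ) hℓ hK hD₃' (by norm_num) g3p)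
  have H24 := poly22_add_piece H23 (poly44_piece_low ((3 * E₀₄ / 8 - 9 * E₂₂ / 2 + 3 * E₄₀ / 8) : ℝ) hℓ hK hD₂' (by norm_num) g2p)
  have H25 := poly22_add_piece H24 (poly44_piece_low ((3 * E₁₄ / 2 - 3 * E₂₃ - 3 * E₃₂ + 3 * E₄₁ / 2 + 14 * μ₆) : ℝ) hℓ hK hD₁' (by norm_num) g1p)
  have H26 := poly22_add_piece H25 (poly44_piece_low ((3 * E₂₄ / 2 - 4 * E₃₃ + 3 * E₄₂ / 2) : ℝ) hℓ hK hD₀' (by norm_num) g0p)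
  have H27 := poly22_add_piece H26 (poly44_piece_main ((9 / 640) : ℝ) hℓ rfl u5)
  have H28 := poly22_add_piece H27 (poly44_piece_low ((9 * E₀₀ / 64) : ℝ) hℓ hK hG₄ (by norm_num) u4)
  have H29 := poly22_add_piece H28 (poly44_piece_low ((9 * E₀₁ / 16 + 9 * E₁₀ / 16 - 15 * μ₂ / 4) : ℝ) hℓ hK hG₃ (by norm_num) u3)
  have H30 := poly22_add_piece H29 (poly44_piece_low ((-9 * E₀₂ / 16 + 9 * E₁₁ / 2 - 9 * E₂₀ / 16) : ℝ) hℓ hK hG₂ (by norm_num) u2)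
  have H31 := poly22_add_piece H30 (poly44_piece_low ((-9 * E₀₃ / 4 + 9 * E₁₂ / 2 + 9 * E₂₁ / 2 - 9 * E₃₀ / 4 + 105 * μ₄ / 2) : ℝ) hℓ hK hG₁ (by norm_num) u1)
  have H32 := poly22_add_piece H31 (poly44_piece_low ((3 * E₀₄ / 8 - 6 * E₁₃ + 27 * E₂₂ / 2 - 6 * E₃₁ + 3 * E₄₀ / 8) : ℝ) hℓ hK hG₀ (by norm_num) u0)
  have H33 := poly22_add_piece H32 (poly44_piece_hyp ((3 / 1280) : ℝ) hℓ (by norm_num) v5)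
  have H34 := poly22_add_piece H33 (poly44_piece_hyp ((3 * E₀₀ / 128) : ℝ) hℓ (by norm_num) v4)
  have H35 := poly22_add_piece H34 (poly44_piece_hyp ((3 * E₀₁ / 32 + 3 * E₁₀ / 32 - 5 * μ₂ / 8) : ℝ) hℓ (by norm_num) v3)
  have H36 := poly22_add_piece H35 (poly44_piece_hyp ((-3 * E₀₂ / 32 + 3 * E₁₁ / 4 - 3 * E₂₀ / 32) : ℝ) hℓ (by norm_num) v2)
  have H37 := poly22_add_piece H36 (poly44_piece_hyp ((-3 * E₀₃ / 8 + 3 * E₁₂ / 4 + 3 * E₂₁ / 4 - 3 * E₃₀ / 8 + 35 * μ₄ / 4) : ℝ) hℓ (by norm_num) v1)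
  have H38 := poly22_add_piece H37 (poly44_piece_hyp ((E₀₄ / 16 - E₁₃ + 9 * E₂₂ / 4 - E₃₁ + E₄₀ / 16) : ℝ) hℓ (by norm_num) v0)
  have H39 := poly22_add_piece H38 (poly44_piece_hyp ((3 / 1280) : ℝ) hℓ (by norm_num) w5)
  have H40 := poly22_add_piece H39 (poly44_piece_hyp ((3 * E₀₀ / 128) : ℝ) hℓ (by norm_num) w4)
  have H41 := poly22_add_piece H40 (poly44_piece_hyp ((3 * E₀₁ / 32 + 3 * E₁₀ / 32 - 5 * μ₂ / 8) : ℝ) hℓ (by norm_num) w3)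
  have H42 := poly22_add_piece H41 (poly44_piece_hyp ((-3 * E₀₂ / 32 + 3 * E₁₁ / 4 - 3 * E₂₀ / 32) : ℝ) hℓ (by norm_num) w2)
  have H43 := poly22_add_piece H42 (poly44_piece_hyp ((-3 * E₀₃ / 8 + 3 * E₁₂ / 4 + 3 * E₂₁ / 4 - 3 * E₃₀ / 8 + 35 * μ₄ / 4) : ℝ) hℓ (by norm_num) w1)
  have H44 := poly22_add_piece H43 (poly44_piece_hyp ((E₀₄ / 16 - E₁₃ + 9 * E₂₂ / 4 - E₃₁ + E₄₀ / 16) : ℝ) hℓ (by norm_num) w0)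
  have H45 := poly22_add_piece H44 (poly44_piece_hyp ((-1 / 384) : ℝ) hℓ (by norm_num) y3)
  have H46 := poly22_add_piece H45 (poly44_piece_hyp ((-E₀₀ / 64) : ℝ) hℓ (by norm_num) y2)
  have H47 := poly22_add_piece H46 (poly44_piece_hyp ((-E₀₁ / 32 - E₁₀ / 32 + 7 * μ₂ / 8) : ℝ) hℓ (by norm_num) y1)
  have H48 := poly22_add_piece H47 (poly44_piece_hyp ((3 * E₀₂ / 32 - E₁₁ / 4 + 3 * E₂₀ / 32) : ℝ) hℓ (by norm_num) y0)
  have H49 := poly22_add_piece H48 (poly44_piece_hyp ((-1 / 384) : ℝ) hℓ (by norm_num) z3)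
  have H50 := poly22_add_piece H49 (poly44_piece_hyp ((-E₀₀ / 64) : ℝ) hℓ (by norm_num) z2)
  have H51 := poly22_add_piece H50 (poly44_piece_hyp ((-E₀₁ / 32 - E₁₀ / 32 + 7 * μ₂ / 8) : ℝ) hℓ (by norm_num) z1)
  have H52 := poly22_add_piece H51 (poly44_piece_hyp ((3 * E₀₂ / 32 - E₁₁ / 4 + 3 * E₂₀ / 32) : ℝ) hℓ (by norm_num) z0)
  have H53 := poly22_add_piece H52 (poly44_piece_hyp ((-5 / 128) : ℝ) hℓ (by norm_num) r3)
  have H54 := poly22_add_piece H53 (poly44_piece_hyp ((-15 * E₀₀ / 64) : ℝ) hℓ (by norm_num) r2)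
  have H55 := poly22_add_piece H54 (poly44_piece_hyp ((-15 * E₀₁ / 32 - 15 * E₁₀ / 32 + 105 * μ₂ / 8) : ℝ) hℓ (by norm_num) r1)
  have H56 := poly22_add_piece H55 (poly44_piece_hyp ((45 * E₀₂ / 32 - 15 * E₁₁ / 4 + 45 * E₂₀ / 32) : ℝ) hℓ (by norm_num) r0)
  have H57 := poly22_add_piece H56 (poly44_piece_hyp ((-5 / 128) : ℝ) hℓ (by norm_num) r3p)
  have H58 := poly22_add_piece H57 (poly44_piece_hyp ((-15 * E₀₀ / 64) : ℝ) hℓ (by norm_num) r2p)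
  have H59 := poly22_add_piece H58 (poly44_piece_hyp ((-15 * E₀₁ / 32 - 15 * E₁₀ / 32 + 105 * μ₂ / 8) : ℝ) hℓ (by norm_num) r1p)
  have H60 := poly22_add_piece H59 (poly44_piece_hyp ((45 * E₀₂ / 32 - 15 * E₁₁ / 4 + 45 * E₂₀ / 32) : ℝ) hℓ (by norm_num) r0p)
  have H61 := poly22_add_piece H60 (poly44_piece_hyp ((1 / 512) : ℝ) hℓ (by norm_num) n1)
  have H62 := poly22_add_piece H61 (poly44_piece_hyp ((E₀₀ / 256) : ℝ) hℓ (by norm_num) n0)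
  have H63 := poly22_add_piece H62 (poly44_piece_hyp ((1 / 512) : ℝ) hℓ (by norm_num) n1p)
  have H64 := poly22_add_piece H63 (poly44_piece_hyp ((E₀₀ / 256) : ℝ) hℓ (by norm_num) n0p)
  have H65 := poly22_add_piece H64 (poly44_piece_hyp ((7 / 128) : ℝ) hℓ (by norm_num) x1)
  have H66 := poly22_add_piece H65 (poly44_piece_hyp ((7 * E₀₀ / 64) : ℝ) hℓ (by norm_num) x0)
  have H67 := poly22_add_piece H66 (poly44_piece_hyp ((7 / 128) : ℝ) hℓ (by norm_num) x1p)
  have H68 := poly22_add_piece H67 (poly44_piece_hyp ((7 * E₀₀ / 64) : ℝ) hℓ (by norm_num) x0p)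
  have H69 := poly22_add_piece H68 (poly44_piece_hyp ((35 / 256) : ℝ) hℓ (by norm_num) o1)
  have H70 := poly22_add_piece H69 (poly44_piece_hyp ((35 * E₀₀ / 128) : ℝ) hℓ (by norm_num) o0)
  have hm : ∀ {x m₁ m₂ d : ℝ}, m₁ = m₂ → |x - m₁| ≤ d → |x - m₂| ≤ d := fun e h ↦ e ▸ h
  refine (hm ?_ H70).trans (le_of_eq ?_)
  · ring
  · ring

end Summit.Parity.GeneralizedHardyLittlewood.Theorems.MomentsBeyondDiagonal.DiagKernel

end
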